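import Summits.ResolutionOfSingularities.ResolutionOfSingularities.Theorems.PurelyInseparableDim4ResConeCInfEntryAtPrime
import HarnessLib
import HarnessLib.Audit.Tags

/-!
# Purely inseparable four-folds — THE WINDOW'S ENTRY `hE` FROM THE CHAIN, EVERY PRIME, MODULO THE FLAG (ENTRY-5b of the
# power-cone light-pair line «light pair of TAIL(p, p−1, 3) ∀ p»; the `(5,4)` instance is res-dim4-p-3 g4's
# `ResCone.cInf_hE_of_chain`, `…ResConeCInfEntryOfChain` p702852) (cell `res-dim4-pi`, K2(p) lane, rung 1)

[OURS · counted 0 · cell `res-dim4-pi` · K2(p) lane (holder res-dim4-p-12 g5, line booked g5-2 (6)); seat res-dim4-p-3 g5.]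
Nothing here proves K2(p) for any `p`, any TAIL(p, p−1, 3), any TAIL(7, d, e), `NoIsolatedTrap p p`, the
Cossart–Jannsen–Saito theorem or resolution of singularities in dimension ≥ 4 / characteristic `p` — NOT proved.  AI kernel
work, weaker than expert review.  **CONDITIONAL**: both theorems below take a form of Q-FLAG AS A HYPOTHESIS.

**`cInf_hE_of_chain_prime_of_cornerFlag`** (`d + 1 = p`, `2 ≤ d`).  Along a witnessed isolated `Step0 p` chain in the
light-pair power-cone regime (shade `≡ d`, `e_G ≡ 3`, weights `≤ 1` of total `2` from `k₀`, slots born from `k₁ ≥ k₀`), ASSUMING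
**Q-FLAG (corner form)** — «every pure-corner slot child `step p univ κ 0 S₂` (order `d + 2`, isolated, `e_G = 3`) of a STRAIGHT
EXACT-LEDGER light-pair state `S₂` (`r = x_λx_μ ∣ F`, order `d + 2`, `resForm = a·x_f^d`, `a ≠ 0`, «`e_f ≤ d−1 ⇒ 2 ≤ e_λ, e_μ`»)
has a FLAGGED ROW: `∃ eu ef, eu + ef = d − 2 ∧ coeff_{r + λ + μ + (eu+1)u + ef·f} ≠ 0`» — the ENTRY BEYOND EVERY INDEX in the
exact currency of res-dim4-typ-1 g5's `SwapTransport.cInf_no_chain_of_entry_prime` (`…SwapTransportWindowResidualPrime`, row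
edition): `∀ k₂ ∃ k ≥ k₂ ∃ λ μ u f π₀ eu ef, … ∧ (c k).r = e_{π₀λ} + e_{π₀μ} ∧ ∀ M N ∃ B₀, ℛ²-relation at precision M ∧ frame
at jet N with dead row (eu, ef) and its flag`.
**`cInf_hE_of_chain_prime_of_chainFlag`** — the same conclusion from the PER-CHAIN form `hQc` (res-dim4-crit-4 g7's remark
SR-4-g7-08, bus 2026-08-29 11:42Z): only the framed pure-corner children PRODUCED BY ENTRY-5a on THIS chain (ℛ²-related to a
real state `c (k′+1)`, `k′ ≥ k₁`, at every precision `M ≥ M₀(k′)`) are asked to carry a flagged row — strictly weaker than the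
universal `hQ`, which implies it (`…_of_cornerFlag` is the three-line corollary).
ROUTE: ENTRY-5a `exists_cInf_framed_entry_at_prime` at `k′ = max k₂ (k₁+1)`; for every `n` the hypothesis picks a flagged
row of the framed child at precision `n` and ENTRY-4 §1 `exists_cInf_virtual_entry_of_rel_prime` gives the block at
`(M, N) = (n, n)`; the row takes finitely many values, so ONE row serves infinitely many `n` (`Finite.exists_infinite_fiber`),
and the block at `(n, n)` weakens to any `M, N ≤ n`.
HONEST STATUS OF THE HYPOTHESIS.  At `p = 5` (`d = 4`, row `(2, 0)`) it is res-dim4-typ-1 g3's theorem `cInf_uFlag_of_child`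
(isolation pins `x_λx_μu³`), so this file re-derives the landed `cInf_hE_of_chain` route for every prime on the same
footing.  At `d ≥ 6` it is OPEN and there is hand evidence AGAINST the universal form (res-dim4-typ-1 g5, bus 2026-08-29
10:47Z / 11:14Z: straight exact-ledger flagless polynomials with isolated axes; full isolation unverified) — if it fails,
this packaging is VACUOUS there and the flagless branch needs a different game (line-polynomial legality, bus (G)).  The
hypothesis is spelled inline (no definition); it is NOT a published fact and NOT claimed.
[cite: CossartJannsenSaito2020, Thm. 3.14, Lemma 13.2] [cite: Hauser2010, §§F–G]
bears_on: LADDER-RESOLUTION:D157-DOOR2 (res-dim4-pi · K2(p) · power cones · window entry from the chain modulo Q-FLAG).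
Supports stmt-ResolutionOfSingularities-16155 (helper).
-/

set_option linter.dupNamespace false -- mandated namespace of this single-conjunct summit

noncomputable section

namespace Summit.ResolutionOfSingularities.ResolutionOfSingularities.Theorems.PIDim4

namespace ResCone

open MvPolynomial Finset FrameChange
open Literature.AlgebraicGeometry.Resolution
open Literature.AlgebraicGeometry.Resolution.CentreBlowup
open Literature.AlgebraicGeometry.Resolution.Hauser2010
open Literature.AlgebraicGeometry.Resolution.HauserPerlega2019

variable {K : Type} [Field K] [DecidableEq K]

/-- **THE WINDOW'S ENTRY `hE` FROM THE CHAIN, every prime, MODULO Q-FLAG ON THIS CHAIN'S FRAMED CHILDREN** (`hQc`: the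
per-chain form; module docstring). [OURS · CONDITIONAL] [cite: CossartJannsenSaito2020, Thm. 3.14, Lemma 13.2] -/
theorem cInf_hE_of_chain_prime_of_chainFlag (p : ℕ) [hp : Fact p.Prime] [CharP K p] {d : ℕ} (hdp : d + 1 = p)
    (hd2 : 2 ≤ d)
    {c : ℕ → State K} {j : ℕ → Fin 4} {b : ℕ → Fin 4 → K}
    (hc : ∀ k, IsIsolated p (c k).F ∧ Step0 p (c k) (c (k + 1))) (hw : FreeTail.IsWitnessedChain p c j b)
    (hr0 : ∀ e ∈ (c 0).F.support, (c 0).r ≤ e) (hfloor : ∀ k, ordZero (c k).F ≠ (p : ℕ)) {k₀ : ℕ}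
    (hshade : ∀ k, k₀ ≤ k → (c k).shade = ((d : ℕ) : ℕ∞))
    (he3 : ∀ k, k₀ ≤ k → Module.finrank K (resVertex (c k)) = 3) {k₁ : ℕ} (hk₁ : k₀ ≤ k₁)
    (hwt : ∀ k, k₀ ≤ k → (∀ i, (c k).r i ≤ 1) ∧ (c k).r.degree = 2)
    (hborn : ∀ k, k₁ ≤ k → ∀ i, 1 ≤ (c k).r i →
      ∃ t, k₀ ≤ t ∧ t < k ∧ j t = i ∧ ∀ m, t < m → m < k → j m ≠ i ∧ b m i = 0)
    (hQc : ∀ k', k₁ ≤ k' → 1 ≤ k' → ∃ M₀ : ℕ, ∀ M, M₀ ≤ M →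
      ∀ (la mu u f κ : Fin 4) (π₀ : Equiv.Perm (Fin 4)) (A₁ S₂ : State K) (Φ : MvPolynomial (Fin 4) K)
        (θ' e' : Fin 4 → MvPolynomial (Fin 4) K) (U' E' : MvPolynomial (Fin 4) K) (a : K),
        la ≠ mu → la ≠ u → la ≠ f → mu ≠ u → mu ≠ f → u ≠ f → (κ = la ∨ κ = mu) →
        θ' (π₀ la) = X la * e' la → θ' (π₀ mu) = X mu * e' mu → constantCoeff (e' la) ≠ 0 → constantCoeff (e' mu) ≠ 0 →
        constantCoeff (θ' (π₀ u)) = 0 → constantCoeff (θ' (π₀ f)) = 0 →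
        coeff (Finsupp.single u 1) (θ' (π₀ u)) * coeff (Finsupp.single f 1) (θ' (π₀ f)) -
          coeff (Finsupp.single f 1) (θ' (π₀ u)) * coeff (Finsupp.single u 1) (θ' (π₀ f)) ≠ 0 →
        constantCoeff U' ≠ 0 → E' ∈ originIdeal K ^ M → A₁.F = deletePthPowers p (U' ^ p * aeval θ' (c (k' + 1)).F) + E' →
        S₂.r = Finsupp.single la 1 + Finsupp.single mu 1 → (∀ e ∈ S₂.F.support, S₂.r ≤ e) →
        ordZero S₂.F = ((d + 2 : ℕ) : ℕ∞) → a ≠ 0 → resForm S₂ = C a * X f ^ d →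
        (∀ e ∈ S₂.F.support, e f ≤ d - 1 → 2 ≤ e la ∧ 2 ≤ e mu) →
        f ∉ Φ.vars → constantCoeff Φ = 0 →
        (CentreBlowup.step p Finset.univ κ 0 S₂).F = deletePthPowers p (tsch f Φ A₁.F) →
        ordZero (CentreBlowup.step p Finset.univ κ 0 S₂).F = ((d + 2 : ℕ) : ℕ∞) →
        IsIsolated p (CentreBlowup.step p Finset.univ κ 0 S₂).F →
        Module.finrank K (resVertex (CentreBlowup.step p Finset.univ κ 0 S₂)) = 3 →
        ∃ eu ef : ℕ, eu + ef = d - 2 ∧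
          coeff ((CentreBlowup.step p Finset.univ κ 0 S₂).r +
            (Finsupp.single la 1 + Finsupp.single mu 1 + Finsupp.single u (eu + 1) + Finsupp.single f ef))
            (CentreBlowup.step p Finset.univ κ 0 S₂).F ≠ 0) :
    ∀ k₂, ∃ k, k₂ ≤ k ∧ ∃ (la mu u f : Fin 4) (π₀ : Equiv.Perm (Fin 4)) (eu ef : ℕ),
      la ≠ mu ∧ la ≠ u ∧ la ≠ f ∧ mu ≠ u ∧ mu ≠ f ∧ u ≠ f ∧ eu + ef = d - 2 ∧
      (c k).r = Finsupp.single (π₀ la) 1 + Finsupp.single (π₀ mu) 1 ∧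
      ∀ M N : ℕ, ∃ B₀ : State K,
        (∃ (θ e : Fin 4 → MvPolynomial (Fin 4) K) (U E : MvPolynomial (Fin 4) K),
          θ (π₀ la) = X la * e la ∧ θ (π₀ mu) = X mu * e mu ∧ constantCoeff (e la) ≠ 0 ∧ constantCoeff (e mu) ≠ 0 ∧
          constantCoeff (θ (π₀ u)) = 0 ∧ constantCoeff (θ (π₀ f)) = 0 ∧
          coeff (Finsupp.single u 1) (θ (π₀ u)) * coeff (Finsupp.single f 1) (θ (π₀ f)) -
            coeff (Finsupp.single f 1) (θ (π₀ u)) * coeff (Finsupp.single u 1) (θ (π₀ f)) ≠ 0 ∧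
          constantCoeff U ≠ 0 ∧ E ∈ originIdeal K ^ M ∧ B₀.F = deletePthPowers p (U ^ p * aeval θ (c k).F) + E) ∧
        ordZero B₀.F = ((d + 2 : ℕ) : ℕ∞) ∧ B₀.r = Finsupp.single la 1 + Finsupp.single mu 1 ∧
        (∀ e ∈ B₀.F.support, B₀.r ≤ e) ∧ (∃ a : K, a ≠ 0 ∧ resForm B₀ = C a * X f ^ d) ∧
        (∀ e ∈ B₀.F.support, e f ≤ d - 1 → 2 ≤ e la ∧ 2 ≤ e mu) ∧
        (∀ e ∈ B₀.F.support, e.degree < N → ¬ (e u = eu ∧ e f = ef)) ∧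
        coeff (B₀.r + (Finsupp.single la 1 + Finsupp.single mu 1 + Finsupp.single u (eu + 1) + Finsupp.single f ef)) B₀.F ≠ 0 ∧
        IsIsolated p B₀.F ∧ Module.finrank K (resVertex B₀) = 3 := by
  intro k₂
  have hk'₁ : k₁ ≤ max k₂ (k₁ + 1) := (Nat.le_succ k₁).trans (le_max_right _ _)
  have hk'1 : 1 ≤ max k₂ (k₁ + 1) := le_trans (by omega) (le_max_right _ _)
  obtain ⟨la, mu, u, f, π₀, hlm, hlu, hlf, hmu, hmf, huf, hr, hdata⟩ :=
    exists_cInf_framed_entry_at_prime p hdp hd2 hc hw hr0 hfloor hshade he3 hk₁ hwt hborn hk'₁ hk'1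
  obtain ⟨M₀, hQ⟩ := hQc _ hk'₁ hk'1
  set k := max k₂ (k₁ + 1) + 1 with hk
  -- for every `n`: a flagged row of the framed child at precision `n + M₀`, and the window block there
  have hblock : ∀ n : ℕ, ∃ ef' : Fin (d - 1), ∃ eu : ℕ, eu + (ef' : ℕ) = d - 2 ∧ ∃ B₀ : State K,
      (∃ (θ e : Fin 4 → MvPolynomial (Fin 4) K) (U E : MvPolynomial (Fin 4) K),
        θ (π₀ la) = X la * e la ∧ θ (π₀ mu) = X mu * e mu ∧ constantCoeff (e la) ≠ 0 ∧ constantCoeff (e mu) ≠ 0 ∧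
        constantCoeff (θ (π₀ u)) = 0 ∧ constantCoeff (θ (π₀ f)) = 0 ∧
        coeff (Finsupp.single u 1) (θ (π₀ u)) * coeff (Finsupp.single f 1) (θ (π₀ f)) -
          coeff (Finsupp.single f 1) (θ (π₀ u)) * coeff (Finsupp.single u 1) (θ (π₀ f)) ≠ 0 ∧
        constantCoeff U ≠ 0 ∧ E ∈ originIdeal K ^ (n + M₀) ∧ B₀.F = deletePthPowers p (U ^ p * aeval θ (c k).F) + E) ∧
      ordZero B₀.F = ((d + 2 : ℕ) : ℕ∞) ∧ B₀.r = Finsupp.single la 1 + Finsupp.single mu 1 ∧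
      (∀ e ∈ B₀.F.support, B₀.r ≤ e) ∧ (∃ a : K, a ≠ 0 ∧ resForm B₀ = C a * X f ^ d) ∧
      (∀ e ∈ B₀.F.support, e f ≤ d - 1 → 2 ≤ e la ∧ 2 ≤ e mu) ∧
      (∀ e ∈ B₀.F.support, e.degree < n + M₀ → ¬ (e u = eu ∧ e f = (ef' : ℕ))) ∧
      coeff (B₀.r + (Finsupp.single la 1 + Finsupp.single mu 1 + Finsupp.single u (eu + 1) +
        Finsupp.single f (ef' : ℕ))) B₀.F ≠ 0 ∧
      IsIsolated p B₀.F ∧ Module.finrank K (resVertex B₀) = 3 := by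
    intro n
    obtain ⟨κ, A₁, S₂, C₁, Φ, θ', e', U', E', a, hκ, h1, h2, h3, h4, h5, h6, h7, h8, h9, h10, hC₁, hrS₂, hdivS₂, hoS₂, ha,
        hresS₂, hledS₂, hΦvars, hΦ0, hC₁F, hoC₁, hrC₁, hdivC₁, hresC₁, hledC₁, hisoC₁, he3C₁⟩ := hdata (n + M₀)
    obtain ⟨eu, ef, hef, hV⟩ := hQ (n + M₀) (by omega) la mu u f κ π₀ A₁ S₂ Φ θ' e' U' E' a hlm hlu hlf hmu hmf huf hκ
      h1 h2 h3 h4 h5 h6 h7 h8 h9 h10 hrS₂ hdivS₂ hoS₂ ha hresS₂ hledS₂ hΦvars hΦ0 (by rw [← hC₁]; exact hC₁F)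
      (by rw [← hC₁]; exact hoC₁) (by rw [← hC₁]; exact hisoC₁) (by rw [← hC₁]; exact he3C₁)
    rw [← hC₁] at hV
    obtain ⟨B₀, hB⟩ := exists_cInf_virtual_entry_of_rel_prime p hdp hd2 hef hlm hlu hlf hmu hmf huf h1 h2 h3 h4 h5 h6 h7
      h8 h9 h10 hΦvars hΦ0 hC₁F hoC₁ hrC₁ hdivC₁ ha hresC₁ hledC₁ hisoC₁ he3C₁ hV (n + M₀)
    exact ⟨⟨ef, by omega⟩, eu, hef, B₀, hB⟩
  choose ρ hρ using hblock
  -- one row serves infinitely many precisions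
  obtain ⟨ef₀, hinf⟩ := Finite.exists_infinite_fiber ρ
  have hinf' : (ρ ⁻¹' {ef₀}).Infinite := Set.infinite_coe_iff.mp hinf
  refine ⟨k, (le_max_left _ _).trans (Nat.le_succ _), la, mu, u, f, π₀, d - 2 - (ef₀ : ℕ), (ef₀ : ℕ), hlm, hlu, hlf, hmu,
    hmf, huf, by have := ef₀.isLt; omega, hr, fun M N => ?_⟩
  obtain ⟨n, hn, hMN⟩ := hinf'.exists_gt (max M N)
  have hρn : ρ n = ef₀ := hn
  obtain ⟨eu, heu, B₀, ⟨θ, e, U, E, h1, h2, h3, h4, h5, h6, h7, h8, h9, h10⟩, ho, hrB, hdiv, hres, hled, hrow, hV, hiso,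
    he3B⟩ := hρ n
  rw [hρn] at heu hrow hV
  obtain rfl : eu = d - 2 - (ef₀ : ℕ) := by omega
  exact ⟨B₀, ⟨θ, e, U, E, h1, h2, h3, h4, h5, h6, h7, h8, Ideal.pow_le_pow_right (by omega) h9, h10⟩, ho, hrB, hdiv, hres,
    hled, fun e' he' hlt => hrow e' he' (lt_of_lt_of_le hlt (by omega)), hV, hiso, he3B⟩

/-- **THE WINDOW'S ENTRY `hE` FROM THE CHAIN, every prime, MODULO Q-FLAG (corner form)** (statement, route and the honest
status of the hypothesis in the module docstring). [OURS · CONDITIONAL] [cite: CossartJannsenSaito2020, Thm. 3.14, Lemma 13.2] -/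
theorem cInf_hE_of_chain_prime_of_cornerFlag (p : ℕ) [hp : Fact p.Prime] [CharP K p] {d : ℕ} (hdp : d + 1 = p)
    (hd2 : 2 ≤ d) {c : ℕ → State K} {j : ℕ → Fin 4} {b : ℕ → Fin 4 → K}
    (hc : ∀ k, IsIsolated p (c k).F ∧ Step0 p (c k) (c (k + 1))) (hw : FreeTail.IsWitnessedChain p c j b)
    (hr0 : ∀ e ∈ (c 0).F.support, (c 0).r ≤ e) (hfloor : ∀ k, ordZero (c k).F ≠ (p : ℕ)) {k₀ : ℕ}
    (hshade : ∀ k, k₀ ≤ k → (c k).shade = ((d : ℕ) : ℕ∞))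
    (he3 : ∀ k, k₀ ≤ k → Module.finrank K (resVertex (c k)) = 3) {k₁ : ℕ} (hk₁ : k₀ ≤ k₁)
    (hwt : ∀ k, k₀ ≤ k → (∀ i, (c k).r i ≤ 1) ∧ (c k).r.degree = 2)
    (hborn : ∀ k, k₁ ≤ k → ∀ i, 1 ≤ (c k).r i →
      ∃ t, k₀ ≤ t ∧ t < k ∧ j t = i ∧ ∀ m, t < m → m < k → j m ≠ i ∧ b m i = 0)
    (hQ : ∀ (la mu u f κ : Fin 4) (S₂ : State K) (a : K), la ≠ mu → la ≠ u → la ≠ f → mu ≠ u → mu ≠ f → u ≠ f →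
      (κ = la ∨ κ = mu) → S₂.r = Finsupp.single la 1 + Finsupp.single mu 1 → (∀ e ∈ S₂.F.support, S₂.r ≤ e) →
      ordZero S₂.F = ((d + 2 : ℕ) : ℕ∞) → a ≠ 0 → resForm S₂ = C a * X f ^ d →
      (∀ e ∈ S₂.F.support, e f ≤ d - 1 → 2 ≤ e la ∧ 2 ≤ e mu) →
      ordZero (CentreBlowup.step p Finset.univ κ 0 S₂).F = ((d + 2 : ℕ) : ℕ∞) →
      IsIsolated p (CentreBlowup.step p Finset.univ κ 0 S₂).F →
      Module.finrank K (resVertex (CentreBlowup.step p Finset.univ κ 0 S₂)) = 3 →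
      ∃ eu ef : ℕ, eu + ef = d - 2 ∧
        coeff ((CentreBlowup.step p Finset.univ κ 0 S₂).r +
          (Finsupp.single la 1 + Finsupp.single mu 1 + Finsupp.single u (eu + 1) + Finsupp.single f ef))
          (CentreBlowup.step p Finset.univ κ 0 S₂).F ≠ 0) :
    ∀ k₂, ∃ k, k₂ ≤ k ∧ ∃ (la mu u f : Fin 4) (π₀ : Equiv.Perm (Fin 4)) (eu ef : ℕ),
      la ≠ mu ∧ la ≠ u ∧ la ≠ f ∧ mu ≠ u ∧ mu ≠ f ∧ u ≠ f ∧ eu + ef = d - 2 ∧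
      (c k).r = Finsupp.single (π₀ la) 1 + Finsupp.single (π₀ mu) 1 ∧
      ∀ M N : ℕ, ∃ B₀ : State K,
        (∃ (θ e : Fin 4 → MvPolynomial (Fin 4) K) (U E : MvPolynomial (Fin 4) K),
          θ (π₀ la) = X la * e la ∧ θ (π₀ mu) = X mu * e mu ∧ constantCoeff (e la) ≠ 0 ∧ constantCoeff (e mu) ≠ 0 ∧
          constantCoeff (θ (π₀ u)) = 0 ∧ constantCoeff (θ (π₀ f)) = 0 ∧
          coeff (Finsupp.single u 1) (θ (π₀ u)) * coeff (Finsupp.single f 1) (θ (π₀ f)) -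
            coeff (Finsupp.single f 1) (θ (π₀ u)) * coeff (Finsupp.single u 1) (θ (π₀ f)) ≠ 0 ∧
          constantCoeff U ≠ 0 ∧ E ∈ originIdeal K ^ M ∧ B₀.F = deletePthPowers p (U ^ p * aeval θ (c k).F) + E) ∧
        ordZero B₀.F = ((d + 2 : ℕ) : ℕ∞) ∧ B₀.r = Finsupp.single la 1 + Finsupp.single mu 1 ∧
        (∀ e ∈ B₀.F.support, B₀.r ≤ e) ∧ (∃ a : K, a ≠ 0 ∧ resForm B₀ = C a * X f ^ d) ∧
        (∀ e ∈ B₀.F.support, e f ≤ d - 1 → 2 ≤ e la ∧ 2 ≤ e mu) ∧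
        (∀ e ∈ B₀.F.support, e.degree < N → ¬ (e u = eu ∧ e f = ef)) ∧
        coeff (B₀.r + (Finsupp.single la 1 + Finsupp.single mu 1 + Finsupp.single u (eu + 1) + Finsupp.single f ef)) B₀.F ≠ 0 ∧
        IsIsolated p B₀.F ∧ Module.finrank K (resVertex B₀) = 3 :=
  cInf_hE_of_chain_prime_of_chainFlag p hdp hd2 hc hw hr0 hfloor hshade he3 hk₁ hwt hborn fun _ _ _ =>
    ⟨0, fun _ _ la mu u f κ _ _ S₂ _ _ _ _ _ a hlm hlu hlf hmu hmf huf hκ _ _ _ _ _ _ _ _ _ _ hrS₂ hdivS₂ hoS₂ ha hresS₂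
      hledS₂ _ _ _ ho' hiso' he3' =>
      hQ la mu u f κ S₂ a hlm hlu hlf hmu hmf huf hκ hrS₂ hdivS₂ hoS₂ ha hresS₂ hledS₂ ho' hiso' he3'⟩

end ResCone

end Summit.ResolutionOfSingularities.ResolutionOfSingularities.Theorems.PIDim4

end
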